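import Summits.BirchSwinnertonDyer.BirchSwinnertonDyer.Theorems.EisensteinPrimesAcTwistDeformationShapiroOnto
import Summits.BirchSwinnertonDyer.BirchSwinnertonDyer.Theorems.EisensteinPrimesAcTwistDeformationCurveAlmostDivisible
import Literature.NumberTheory.EllipticCurves.IwasawaAlgebraPseudoNullProofs
import Literature.NumberTheory.EllipticCurves.IwasawaAlgebraCharAnnihilatorProofs
import HarnessLib

/-!
# The Shapiro descent identifies `S_{𝓛^{v̄}}(K, 𝐃_E)` with Castella's `Sf`-imprimitive `Sel^{Sf}_{v̄}(K_∞, E[p^∞])`, `T ↦ conj_γ − 1`;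
# hence `corank_Λ S_{𝓛^{v̄}}(K, 𝐃_E) = 0` from the cotorsion of `𝔛^{Sf}_f`, and `𝔛^{Sf}_f` HAS NO NON-ZERO FINITE `Λ`-SUBMODULE
# whenever `S_{𝓛^{v̄}}(K, 𝐃_E)` is almost divisible
# (cell `bsd-eis`, width seat `bsd-line-x2-p2` gen 7; crux 4 `BSDpOnCellC` stmt-BirchSwinnertonDyer-19034, line b1 v12; sequel of
# `…CurveAlmostDivisible` (p651263) and `…ShapiroOnto`)

HONEST FRAMING (cell `bsd-eis`, run/shared/lean/pub/bsd-eis/): plumbing on constructed objects; no definition, no named fact, no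
`sorry`, no `Theses` import; nothing about BSD or a main conjecture is asserted; nothing booked; no label or count moves. Helper
`--supports stmt-BirchSwinnertonDyer-19034`; closes no stub. UNCONDITIONAL (the almost-divisibility is an INPUT here; its
published-fact price is paid in `…CurveAlmostDivisible`).

## What

Data (as in x1-w3 g3's `…CurveCotorsion`): `W/K` elliptic, `K` totally complex, `S ⊇ {w ∣ p}` with `S ∩ {w ∤ p} = Sf` and `W` good
at every `w ∉ S`, `w ∤ p`; `ρ₀` a continuous `ℤ_p`-linear action of `G_{K,S}` on `E[p^∞] = PrimaryTorsion W.geomPoints p` with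
`ρ₀(σ̄) P = σ • P`; `v̄ ∈ S` above `p`; `γ` a topological generator of `κ`; `L` ANY specification with
`L w = if w = v̄ then ⊥ else ⊤`; `F` ANY additive map with the Shapiro-descent formula `F[c] = [h ↦ c(h̄)(0)]` (LEAD g2's
`exists_shapiroDescent` with `ψ = id`).

* §1 `shapiroDescent_mem_selmerAc_of_loc_eq_zero` (INTO: `loc_v̄[c] = 0 ⟹ F[c] ∈ selmerAc W p κ v̄ Sf`; strict at `v̄` by LEAD g2's
  dictionary, trivial at the good `w ∉ S` because unramified there, no archimedean condition at complex places),
  `exists_loc_eq_zero_and_shapiroDescent_eq_of_mem_selmerAc` (ONTO: a class of `selmerAc … Sf` is unramified outside `S`, hence `F`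
  of some `c` by `exists_shapiroDescent_eq_of_mem_unramifiedOutside`, and `loc_v̄[c] = 0` by the converse dictionary
  `loc_eq_zero_of_forall_conjH1_shapiroDescent_mem_awayKer`), **`exists_addMonoidHom_strictAtSelmer_bijective`**: a BIJECTIVE
  additive `φ : S_L(K, 𝐃_E) → selmerAc W p κ v̄ Sf` with `φ (T • s) = (conj_γ − 1)(φ s)`.
* §2 **`hasCorank_strictAtSelmer_zero_of_xAc`** — `corank_Λ S_L(K, 𝐃_E) = 0` from `𝔛^{Sf}_f = XAc W p κ v̄ Sf γ` finitely generated and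
  `Λ`-torsion (Castella's dual pair `XAc.isDualPair` surjects `Λ`-linearly onto `Hom(S_L, ℚ/ℤ)` along `φ`); this is the input `hSel`
  of `primaryTorsion_strictAtSelmer_isAlmostDivisible`.
* §3 **`xAc_eq_bot_of_finite_of_isAlmostDivisible`** — if `S_L(K, 𝐃_E)` is almost `Λ`-divisible then EVERY FINITE `Λ`-SUBMODULE OF
  `𝔛^{Sf}_f` IS `⊥`: `𝔛^{Sf}_f` is a balanced Pontryagin dual of `S_L` through `φ` (the `Λ`-linear bijection onto
  `CharacterModule S_L`, `IwasawaDual.IsDualPair.exists_linearMap_comp_surjective` + `injective_of_toDual_comp`), finite ⟹ pseudo-null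
  over `Λ = ℤ_p⟦T⟧` (`isPseudoNull_of_finite`); and **`xAc_pTorsion_eq_zero_of_isAlmostDivisible`**: with `𝔛^{Sf}_f`
  finitely generated, torsion, `μ = 0` — NO `p`-TORSION (`eq_zero_of_C_p_smul_eq_zero_of_muInvariant_eq_zero`): the hypothesis
  `∀ x, p • x = 0 → x = 0` of g6's `lambdaInvariant_le_add_of_isResidualPairOver_of_not_split` (p649247).

References: [Greenberg2006] Thm. 3 p. 342; [Castella2018] Def. 2.2; [GreenbergLNM1716] §1 p. 60; [Greenberg2016Selmer] §1 p. 2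
(almost divisible ⇔ no non-zero pseudo-null submodule in the dual); [Washington1997] §13.2; [CastellaGrossiLeeSkinner2022] Cor. 1.4.3;
[KellerYin2024] §1.4 (e) (arXiv:2402.12781v2 TeX L1162–1181).
-/

set_option autoImplicit false
set_option linter.dupNamespace false -- the summit namespace `…BirchSwinnertonDyer.BirchSwinnertonDyer.Theorems` (Sub = Summit, D-0017) trips it

noncomputable section

open scoped Classical
open NumberField IsDedekindDomain Field PowerSeries
open Literature.NumberTheory.EllipticCurves Literature.NumberTheory.EllipticCurves.GreenbergSelmer
  Literature.NumberTheory.EllipticCurves.GreenbergVatsal2000 Literature.NumberTheory.GaloisRepresentations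
  Literature.NumberTheory.EllipticCurves.IwasawaDual Literature.NumberTheory.EllipticCurves.Castella2018.AcSelmer
  Literature.NumberTheory.IwasawaTheory Literature.NumberTheory.IwasawaTheory.Greenberg2016
  Literature.NumberTheory.IwasawaTheory.Greenberg2006
  Summit.BirchSwinnertonDyer.BirchSwinnertonDyer.Theorems.GreenbergFullAtSelmer

namespace Summit.BirchSwinnertonDyer.BirchSwinnertonDyer.Theorems.AcTwistDeformation

section CurveStrictAt

variable {K : Type} [Field K] [NumberField K] (S : Set (HeightOneSpectrum (𝓞 K))) {p : ℕ} [Fact p.Prime]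
  (W : WeierstrassCurve K) [W.IsElliptic]
  [TopologicalSpace (PowerSeries ℤ_[p])] [IsTopologicalRing (PowerSeries ℤ_[p])]
  [IsTopologicalAddGroup (BigRepModule ℤ_[p] p (PrimaryTorsion W.geomPoints p))]
  [ContinuousSMul (PowerSeries ℤ_[p]) (BigRepModule ℤ_[p] p (PrimaryTorsion W.geomPoints p))]
  (hS : ∀ v : HeightOneSpectrum (𝓞 K), ((p : ℕ) : 𝓞 K) ∈ v.asIdeal → v ∈ S)
  (κ : ZpExtension K p)
  (ρ₀ : ContinuousRep (GaloisGroupUnramifiedOutside K S) ℤ_[p] (PrimaryTorsion W.geomPoints p))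
  (hρ₀ : ∀ (σ : absoluteGaloisGroup K) (P : PrimaryTorsion W.geomPoints p), ρ₀ (toUnramifiedQuot K S σ) P = σ • P)
  (hKc : ∀ w : InfinitePlace K, w.IsComplex)
  {vbar : HeightOneSpectrum (𝓞 K)} (hvbar : ((p : ℕ) : 𝓞 K) ∈ vbar.asIdeal)
  (Sf : Set (HeightOneSpectrum (𝓞 K))) (hSf₁ : Sf ⊆ S)
  (hSf₂ : ∀ w ∈ S, ((p : ℕ) : 𝓞 K) ∉ w.asIdeal → w ∈ Sf)
  (hgood : ∀ w : HeightOneSpectrum (𝓞 K), w ∉ S → ((p : ℕ) : 𝓞 K) ∉ w.asIdeal → W.HasGoodReductionAt w)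
  {F : (bigRep (κ.liftUnramifiedOutside S hS) ρ₀).H 1 →+ W.subgroupH1 p κ.kerSubgroup}
  (hF : ∀ (c : contOneCocycles (bigRep (κ.liftUnramifiedOutside S hS) ρ₀).toTopRep)
    (z : contOneCocycles (discreteTopRep κ.kerSubgroup (W.geomPrimaryTorsion p))),
    (∀ h : κ.kerSubgroup, z.1 h = (AddEquiv.refl _ : PrimaryTorsion W.geomPoints p ≃+ W.geomPrimaryTorsion p)
      ((c.1 (toUnramifiedQuot K S h) : BigRepModule ℤ_[p] p (PrimaryTorsion W.geomPoints p)) 0)) →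
    F (oneCocycleClass _ c) = oneCocycleClass _ z)

/-! ## §1 INTO, ONTO, and the bijection -/

include hρ₀ hKc hSf₂ hgood hF in
/-- **INTO**: if `loc_v̄[c] = 0` then `F[c] ∈ selmerAc W p κ v̄ Sf` — strict at `v̄` (LEAD g2's `loc = 0 ⟹ awayKer` + `strictKer
= awayKer` for `M⁺ = 0`), locally trivial at the good places `w ∉ S` (unramified there ⟹ trivial: totally split `w` by
`Frob − 1` onto `E[p^∞]`, finitely decomposed `w` by the pro-`p′` residual tower), no archimedean condition at complex places; at
`w ∈ S`, `w ∤ p` there is no condition (`w ∈ Sf`). [cite: Castella2018, Def. 2.2 (arXiv:1704.06608 p. 5)] [cite: Greenberg2006, Thm. 3 p. 342] -/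
theorem shapiroDescent_mem_selmerAc_of_loc_eq_zero
    (c : contOneCocycles (bigRep (κ.liftUnramifiedOutside S hS) ρ₀).toTopRep)
    (hloc : loc S (bigRep (κ.liftUnramifiedOutside S hS) ρ₀) (Sum.inr vbar) 1 (oneCocycleClass _ c) = 0) :
    F (oneCocycleClass _ c) ∈ selmerAc W p κ vbar Sf := by
  let ψ : PrimaryTorsion W.geomPoints p ≃+ W.geomPrimaryTorsion p := AddEquiv.refl _
  have hψ : ∀ (σ : absoluteGaloisGroup K) (a : PrimaryTorsion W.geomPoints p),
      ψ (ρ₀ (toUnramifiedQuot K S σ) a) = σ • ψ a := fun σ a ↦ by rw [hρ₀]; rfl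
  have hA : ∀ a : PrimaryTorsion W.geomPoints p, ∃ k : ℕ, p ^ k • a = 0 := fun a ↦ by
    obtain ⟨k, hk⟩ := a.exists_pow_smul_eq_zero
    exact ⟨k, PrimaryTorsion.ext (by rw [PrimaryTorsion.val_nsmul]; exact hk)⟩
  have hM : ∀ m : W.geomPrimaryTorsion p, ∃ k : ℕ, p ^ k • m = 0 := fun m ↦ hA m
  have hstab : ∀ m : W.geomPrimaryTorsion p,
      IsOpen (MulAction.stabilizer (absoluteGaloisGroup K) m : Set (absoluteGaloisGroup K)) :=
    AcSigned.isOpen_stabilizer_geomPrimaryTorsion W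
  change F (oneCocycleClass _ c) ∈ selmerOver κ.kerSubgroup (W.geomPrimaryTorsion p) p vbar Sf
  rw [mem_selmerOver_iff]
  refine ⟨fun w hpw hwSf σ ↦ ?_, fun w σ ↦ ?_, fun σ ↦ ?_⟩
  · -- `w ∤ p`, `w ∉ Sf`, hence `w ∉ S`: good, unramified ⟹ locally trivial
    have hwS : w ∉ S := fun h ↦ hwSf (hSf₂ w h hpw)
    have hunr := conjH1_shapiroDescent_mem_unramifiedKer_of_not_mem S hS κ ρ₀ ψ hψ hF hwS c σ
    by_cases hD : decomp (K := K) w ≤ κ.kerSubgroup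
    · exact UniversalToricDescentTwistedDescent.unramifiedKer_le_awayKer_kerSubgroup_of_decomp_le W p κ
        hpw (hgood w hwS hpw) hD hunr
    · exact UnramifiedLeAwayKer.unramifiedKer_le_awayKer_of_not_decomp_le (κ := κ) hstab hM
        (IwasawaTwoVariable.inertia_le_kerSubgroup_of_not_mem κ hpw) hD hunr
  · exact Summit.BirchSwinnertonDyer.Rank1Residual.X11b.Coinv.mem_infKer_of_decompInf_eq_bot w
      (BigGaloisRep.decompInf_eq_bot_of_isComplex (hKc w)) _
  · rw [Literature.NumberTheory.EllipticCurves.BigGaloisRep.strictKer_strictDatum_eq_awayKer]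
    exact conjH1_shapiroDescent_mem_awayKer_of_loc_eq_zero S hS κ ρ₀ ψ hψ hA hF vbar c hloc σ

omit [W.IsElliptic] in
include hρ₀ hSf₁ hF in
/-- **ONTO**: every class of `selmerAc W p κ v̄ Sf` is `F[c]` for a cocycle `c` with `loc_v̄[c] = 0` — it is unramified outside
`S` (locally trivial ⟹ unramified at every `w ∉ S ⊇ Sf`, `w ∤ p`), so `…ShapiroOnto` produces `c`, and its conjugates are locally
trivial above `v̄` (the strict condition), so `loc_v̄[c] = 0` by the converse dictionary. [cite: Castella2018, Def. 2.2 (arXiv:1704.06608 p. 5)]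
[cite: Greenberg2006, Thm. 3 p. 342] -/
theorem exists_loc_eq_zero_and_shapiroDescent_eq_of_mem_selmerAc
    (y : W.subgroupH1 p κ.kerSubgroup) (hy : y ∈ selmerAc W p κ vbar Sf) :
    ∃ c : contOneCocycles (bigRep (κ.liftUnramifiedOutside S hS) ρ₀).toTopRep,
      loc S (bigRep (κ.liftUnramifiedOutside S hS) ρ₀) (Sum.inr vbar) 1 (oneCocycleClass _ c) = 0 ∧
        F (oneCocycleClass _ c) = y := by
  let ψ : PrimaryTorsion W.geomPoints p ≃+ W.geomPrimaryTorsion p := AddEquiv.refl _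
  have hψ : ∀ (σ : absoluteGaloisGroup K) (a : PrimaryTorsion W.geomPoints p),
      ψ (ρ₀ (toUnramifiedQuot K S σ) a) = σ • ψ a := fun σ a ↦ by rw [hρ₀]; rfl
  have hA : ∀ a : PrimaryTorsion W.geomPoints p, ∃ k : ℕ, p ^ k • a = 0 := fun a ↦ by
    obtain ⟨k, hk⟩ := a.exists_pow_smul_eq_zero
    exact ⟨k, PrimaryTorsion.ext (by rw [PrimaryTorsion.val_nsmul]; exact hk)⟩
  have hy' := hy
  change y ∈ selmerOver κ.kerSubgroup (W.geomPrimaryTorsion p) p vbar Sf at hy'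
  rw [mem_selmerOver_iff] at hy'
  -- unramified outside `S`
  have hunr : y ∈ GreenbergVatsal2000.unramifiedOutside κ.kerSubgroup (W.geomPrimaryTorsion p) p S := by
    rw [GreenbergVatsal2000.mem_unramifiedOutside_iff]
    intro w hwS hpw σ
    exact awayKer_le_unramifiedKer (M := W.geomPrimaryTorsion p) κ.kerSubgroup w
      (hy'.1 w hpw (fun h ↦ hwS (hSf₁ h)) σ)
  obtain ⟨ξ, hξ⟩ := exists_shapiroDescent_eq_of_mem_unramifiedOutside S hS κ ρ₀ ψ hψ hA hF y hunr
  obtain ⟨c, rfl⟩ := oneCocycleClass_surjective _ ξ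
  refine ⟨c, ?_, hξ⟩
  refine loc_eq_zero_of_forall_conjH1_shapiroDescent_mem_awayKer S hS κ ρ₀ ψ hψ hA hF vbar c fun σ ↦ ?_
  rw [hξ, ← Literature.NumberTheory.EllipticCurves.BigGaloisRep.strictKer_strictDatum_eq_awayKer]
  exact hy'.2.2 σ

include hρ₀ hKc hvbar hSf₁ hSf₂ hgood hF in
/-- **`S_{𝓛^{v̄}}(K, 𝐃_E) ≅ selmerAc W p κ v̄ Sf` as abelian groups, `T ↦ conj_γ − 1`.** For ANY specification `L` with
`L w = if w = v̄ then ⊥ else ⊤` there is a BIJECTIVE additive `φ : S_L(K, 𝐃_E) → selmerAc W p κ v̄ Sf`, `φ s = F s`, with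
`φ (T • s) = (conj_γ − 1)(φ s)` (LEAD g2's orientation `shapiroDescent_X_smul`): injective by
`oneCocycleClass_eq_zero_of_shapiroDescent_eq_zero`, onto and into by §1, membership `c ∈ S_L ↔ loc_v̄ c = 0`
(`mem_selmer_strictAt_iff`). [cite: Greenberg2006, Thm. 3 p. 342 ("as `Λ`-modules")] [cite: Castella2018, §2.2 Def. 2.2] -/
theorem exists_addMonoidHom_strictAtSelmer_bijective {γ : absoluteGaloisGroup K} [hγ : Fact (κ.IsTopGenerator γ)]
    (L : Specification S (bigRep (κ.liftUnramifiedOutside S hS) ρ₀))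
    (hL : ∀ w : Place K, L w = if w = Sum.inr vbar then ⊥ else ⊤) :
    ∃ φ : L.selmer →+ selmerAc W p κ vbar Sf, Function.Bijective φ ∧
      (∀ s : L.selmer, ((φ s : selmerAc W p κ vbar Sf) : W.subgroupH1 p κ.kerSubgroup) =
        F (s : (bigRep (κ.liftUnramifiedOutside S hS) ρ₀).H 1)) ∧
      ∀ s : L.selmer, φ (DistribSMul.toAddMonoidHom L.selmer (PowerSeries.X : PowerSeries ℤ_[p]) s) =
        (conjSelmerAc W p κ vbar Sf γ - 1) (φ s) := by
  let ψ : PrimaryTorsion W.geomPoints p ≃+ W.geomPrimaryTorsion p := AddEquiv.refl _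
  have hψ : ∀ (σ : absoluteGaloisGroup K) (a : PrimaryTorsion W.geomPoints p),
      ψ (ρ₀ (toUnramifiedQuot K S σ) a) = σ • ψ a := fun σ a ↦ by rw [hρ₀]; rfl
  have hA : ∀ a : PrimaryTorsion W.geomPoints p, ∃ k : ℕ, p ^ k • a = 0 := fun a ↦ by
    obtain ⟨k, hk⟩ := a.exists_pow_smul_eq_zero
    exact ⟨k, PrimaryTorsion.ext (by rw [PrimaryTorsion.val_nsmul]; exact hk)⟩
  have hvS : vbar ∈ S := hS vbar hvbar
  -- INTO
  have hmem : ∀ s : L.selmer, F (s : (bigRep (κ.liftUnramifiedOutside S hS) ρ₀).H 1) ∈ selmerAc W p κ vbar Sf := by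
    rintro ⟨ξ, hξ⟩
    obtain ⟨c, rfl⟩ := oneCocycleClass_surjective _ ξ
    exact shapiroDescent_mem_selmerAc_of_loc_eq_zero S W hS κ ρ₀ hρ₀ hKc Sf hSf₂ hgood hF c
      ((mem_selmer_strictAt_iff L hL hvS _).1 hξ)
  let φ : L.selmer →+ selmerAc W p κ vbar Sf :=
    { toFun := fun s ↦ ⟨F s, hmem s⟩
      map_zero' := Subtype.ext (by simp)
      map_add' := fun s t ↦ Subtype.ext (by simp) }
  refine ⟨φ, ⟨?_, ?_⟩, fun s ↦ rfl, fun s ↦ ?_⟩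
  · -- injective
    refine (injective_iff_map_eq_zero φ).2 fun s hs ↦ ?_
    have h0 : F (s : (bigRep (κ.liftUnramifiedOutside S hS) ρ₀).H 1) = 0 := congrArg Subtype.val hs
    obtain ⟨c, hc⟩ := oneCocycleClass_surjective _ (s : (bigRep (κ.liftUnramifiedOutside S hS) ρ₀).H 1)
    rw [← hc] at h0
    exact Subtype.ext (hc.symm.trans
      (oneCocycleClass_eq_zero_of_shapiroDescent_eq_zero S hS κ ρ₀ ψ hψ hA hF c h0))
  · -- surjective
    rintro ⟨y, hy⟩
    obtain ⟨c, hloc, hcy⟩ := exists_loc_eq_zero_and_shapiroDescent_eq_of_mem_selmerAc S W hS κ ρ₀ hρ₀ Sf hSf₁ hF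
      y hy
    exact ⟨⟨oneCocycleClass _ c, (mem_selmer_strictAt_iff L hL hvS _).2 hloc⟩, Subtype.ext hcy⟩
  · -- the orientation
    apply Subtype.ext
    change F ((PowerSeries.X : PowerSeries ℤ_[p]) • (s : (bigRep (κ.liftUnramifiedOutside S hS) ρ₀).H 1)) =
      W.conjH1 p κ.kerSubgroup γ (F s) - F s
    exact shapiroDescent_X_smul S hS κ ρ₀ ψ hψ hF hγ.out _

/-! ## §2 `corank_Λ S_{𝓛^{v̄}}(K, 𝐃_E) = 0` from the cotorsion of `𝔛^{Sf}_f` -/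

include hρ₀ hKc hvbar hSf₁ hSf₂ hgood hF in
/-- **`corank_Λ S_L(K, 𝐃_E) = 0` FROM THE `Λ`-COTORSION OF `𝔛^{Sf}_f = XAc W p κ v̄ Sf γ`** (finitely generated and torsion): along
the injective `φ` of §1 Castella's dual pair `XAc.isDualPair` surjects `Λ`-linearly onto `Hom(S_L, ℚ/ℤ)`
(`IwasawaDual.IsDualPair.exists_linearMap_comp_surjective`), so every Pontryagin dual of `S_L` is finitely generated torsion.
The `Sf`-imprimitive twin of x1-w3 g3's `hasCorank_fullAtSelmer_zero_of_xAc`; the input `hSel` of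
`primaryTorsion_strictAtSelmer_isAlmostDivisible`. [cite: Greenberg2006, Thm. 3 p. 342] [cite: GreenbergLNM1716, §1 p. 60] -/
theorem hasCorank_strictAtSelmer_zero_of_xAc {γ : absoluteGaloisGroup K} [Fact (κ.IsTopGenerator γ)]
    (L : Specification S (bigRep (κ.liftUnramifiedOutside S hS) ρ₀))
    (hL : ∀ w : Place K, L w = if w = Sum.inr vbar then ⊥ else ⊤)
    (hXfin : Module.Finite (IwasawaAlgebra p) (XAc W p κ vbar Sf γ))
    (hXtor : Module.IsTorsion (IwasawaAlgebra p) (XAc W p κ vbar Sf γ)) :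
    HasCorank (PowerSeries ℤ_[p]) L.selmer 0 := by
  obtain ⟨φ, hφbij, -, hφ⟩ := exists_addMonoidHom_strictAtSelmer_bijective S W hS κ ρ₀ hρ₀ hKc hvbar Sf hSf₁ hSf₂ hgood hF
    (γ := γ) L hL
  have h := XAc.isDualPair W p κ vbar Sf γ
  have h' := isDualPair_characterModule_selmer S hS κ ρ₀ L
  obtain ⟨G, hGsurj, -⟩ := h.exists_linearMap_comp_surjective h' φ hφ hφbij.1
  haveI : Module.Finite (PowerSeries ℤ_[p]) (XAc W p κ vbar Sf γ) := hXfin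
  have htor : Module.IsTorsion (PowerSeries ℤ_[p]) (CharacterModule L.selmer) := fun x ↦ by
    obtain ⟨y, rfl⟩ := hGsurj x
    obtain ⟨a, ha⟩ := @hXtor y
    refine ⟨a, ?_⟩
    rw [Submonoid.smul_def] at ha ⊢
    rw [← map_smul, ha, map_zero]
  intro Y _ _ toDual hY
  let e := hY.linearEquiv (isDualPairing_characterModule (PowerSeries ℤ_[p]) L.selmer)
  haveI : Module.Finite (PowerSeries ℤ_[p]) (CharacterModule L.selmer) := Module.Finite.of_surjective G hGsurj
  haveI : Module.Finite (PowerSeries ℤ_[p]) Y := Module.Finite.equiv e.symm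
  refine (Module.finrank_eq_zero_iff_isTorsion (R := PowerSeries ℤ_[p]) (M := Y)).mpr fun y ↦ ?_
  obtain ⟨a, ha⟩ := @htor (e y)
  refine ⟨a, e.injective ?_⟩
  rw [Submonoid.smul_def] at ha ⊢
  rw [map_smul, ha, map_zero]

/-! ## §3 `𝔛^{Sf}_f` has no non-zero finite `Λ`-submodule, and no `p`-torsion, when `S_{𝓛^{v̄}}(K, 𝐃_E)` is almost divisible -/

include hρ₀ hKc hvbar hSf₁ hSf₂ hgood hF in
/-- **`𝔛^{Sf}_f` IS A BALANCED PONTRYAGIN DUAL OF `S_L(K, 𝐃_E)` ⟹ no non-zero pseudo-null submodule when `S_L` is almost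
divisible.** The `Λ`-linear `G : XAc W p κ v̄ Sf γ → CharacterModule S_L`, `G x = x ∘ φ`, is onto (`φ` injective) and injective
(`φ` onto), hence a Greenberg dual pairing `IsDualPairing Λ S_L G`; `IsAlmostDivisible Λ S_L` then says every pseudo-null
`Λ`-submodule of `𝔛^{Sf}_f` is `⊥`. [cite: Greenberg2016Selmer, §1 p. 2 L17–35 (almost divisible ⇔ no non-zero pseudo-null submodule)]
[cite: GreenbergLNM1716, §1 p. 60] -/
theorem xAc_hasNoPseudoNullSubmodule_of_isAlmostDivisible {γ : absoluteGaloisGroup K} [Fact (κ.IsTopGenerator γ)]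
    (L : Specification S (bigRep (κ.liftUnramifiedOutside S hS) ρ₀))
    (hL : ∀ w : Place K, L w = if w = Sum.inr vbar then ⊥ else ⊤)
    (hAD : IsAlmostDivisible (PowerSeries ℤ_[p]) L.selmer) :
    HasNoPseudoNullSubmodule (PowerSeries ℤ_[p]) (XAc W p κ vbar Sf γ) := by
  obtain ⟨φ, hφbij, -, hφ⟩ := exists_addMonoidHom_strictAtSelmer_bijective S W hS κ ρ₀ hρ₀ hKc hvbar Sf hSf₁ hSf₂ hgood hF
    (γ := γ) L hL
  have h := XAc.isDualPair W p κ vbar Sf γ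
  have h' := isDualPair_characterModule_selmer S hS κ ρ₀ L
  obtain ⟨G, hGsurj, hG⟩ := h.exists_linearMap_comp_surjective h' φ hφ hφbij.1
  have hGinj : Function.Injective G := h.injective_of_toDual_comp φ hφbij.2 hG
  have hpair : IsDualPairing (PowerSeries ℤ_[p]) L.selmer
      (G.toAddMonoidHom : XAc W p κ vbar Sf γ →+ (L.selmer →+ AddCircle (1 : ℚ))) :=
    { bijective := ⟨hGinj, hGsurj⟩
      map_smul := fun r x s ↦ by
        change G (r • x) s = G x (r • s)
        rw [map_smul]
        exact (isDualPairing_characterModule (PowerSeries ℤ_[p]) L.selmer).map_smul r (G x) s }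
  exact hAD (XAc W p κ vbar Sf γ) G.toAddMonoidHom hpair

include hρ₀ hKc hvbar hSf₁ hSf₂ hgood hF in
/-- **Every FINITE `Λ`-submodule of `𝔛^{Sf}_f` is `⊥`** when `S_L(K, 𝐃_E)` is almost divisible (finite ⟹ pseudo-null over
`Λ = ℤ_p⟦T⟧`, `isPseudoNull_of_finite`). «`𝔛^{Sf}_f` has no non-zero finite `Λ`-submodule» — CGLS22 Cor. 1.4.3 /
Keller–Yin §1.4 (e) for the curve, at the `Sf`-imprimitive level. [cite: CastellaGrossiLeeSkinner2022, Cor. 1.4.3]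
[cite: KellerYin2024, §1.4 (e) (arXiv:2402.12781v2 TeX L1162–1181)] [cite: NeukirchSchmidtWingberg2008, Ch. V §1 (5.1.4) Remark 4] -/
theorem xAc_eq_bot_of_finite_of_isAlmostDivisible {γ : absoluteGaloisGroup K} [Fact (κ.IsTopGenerator γ)]
    (L : Specification S (bigRep (κ.liftUnramifiedOutside S hS) ρ₀))
    (hL : ∀ w : Place K, L w = if w = Sum.inr vbar then ⊥ else ⊤)
    (hAD : IsAlmostDivisible (PowerSeries ℤ_[p]) L.selmer)
    (N : Submodule (IwasawaAlgebra p) (XAc W p κ vbar Sf γ)) (hN : Finite N) : N = ⊥ :=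
  xAc_hasNoPseudoNullSubmodule_of_isAlmostDivisible S W hS κ ρ₀ hρ₀ hKc hvbar Sf hSf₁ hSf₂ hgood hF L hL hAD N
    (Literature.NumberTheory.EllipticCurves.isPseudoNull_of_finite p N)

include hρ₀ hKc hvbar hSf₁ hSf₂ hgood hF in
/-- **`𝔛^{Sf}_f` HAS NO `p`-TORSION** when it is finitely generated, `Λ`-torsion with `μ = 0` and `S_L(K, 𝐃_E)` is almost divisible:
`μ = 0` makes `𝔛^{Sf}_f` finitely generated over `ℤ_p`, so its `p`-torsion is a finite `Λ`-submodule, hence `⊥`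
(`eq_zero_of_C_p_smul_eq_zero_of_muInvariant_eq_zero`). This is the hypothesis `∀ x, p • x = 0 → x = 0` of g6's
`lambdaInvariant_le_add_of_isResidualPairOver_of_not_split`. [cite: Washington1997, §13.2] [cite: CastellaGrossiLeeSkinner2022, Cor. 1.4.3]
[cite: KellerYin2024, §1.4 (e) (arXiv:2402.12781v2 TeX L1162–1181)] -/
theorem xAc_eq_zero_of_smul_eq_zero_of_isAlmostDivisible {γ : absoluteGaloisGroup K} [Fact (κ.IsTopGenerator γ)]
    (L : Specification S (bigRep (κ.liftUnramifiedOutside S hS) ρ₀))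
    (hL : ∀ w : Place K, L w = if w = Sum.inr vbar then ⊥ else ⊤)
    (hAD : IsAlmostDivisible (PowerSeries ℤ_[p]) L.selmer)
    (hXfin : Module.Finite (IwasawaAlgebra p) (XAc W p κ vbar Sf γ))
    (hXtor : Module.IsTorsion (IwasawaAlgebra p) (XAc W p κ vbar Sf γ))
    (hμ : muInvariant p (XAc W p κ vbar Sf γ) = 0)
    (x : XAc W p κ vbar Sf γ) (hx : p • x = 0) : x = 0 := by
  letI : Module ℤ_[p] (XAc W p κ vbar Sf γ) := Module.compHom _ (algebraMap ℤ_[p] (IwasawaAlgebra p))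
  haveI : IsScalarTower ℤ_[p] (IwasawaAlgebra p) (XAc W p κ vbar Sf γ) := IsScalarTower.of_compHom ℤ_[p] _ _
  haveI := hXfin
  refine IwasawaAlgebra.eq_zero_of_C_p_smul_eq_zero_of_muInvariant_eq_zero (p := p) (M := XAc W p κ vbar Sf γ) hXtor
    (fun N hN ↦ xAc_eq_bot_of_finite_of_isAlmostDivisible S W hS κ ρ₀ hρ₀ hKc hvbar Sf hSf₁ hSf₂ hgood hF L hL hAD N hN) hμ ?_
  rw [map_natCast, Nat.cast_smul_eq_nsmul]
  exact hx

end CurveStrictAt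

end Summit.BirchSwinnertonDyer.BirchSwinnertonDyer.Theorems.AcTwistDeformation

end
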